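import Mathlib.Analysis.Distribution.SchwartzSpace.Basic
import Mathlib.Analysis.Calculus.MeanValue
import Mathlib.Analysis.Calculus.IteratedDeriv.Defs
import Mathlib.Analysis.Calculus.ContDiff.Deriv
import Mathlib.Analysis.SpecialFunctions.JapaneseBracket
import Mathlib.Topology.MetricSpace.HausdorffDistance
import HarnessLib

/-!
# Schwartz functions supported in an open set vanish to infinite order at its boundary,
quantitatively; integrability against kernels with polynomial blow-up at the boundary

Topic `Literature/Analysis/Distribution`. A Schwartz function `F` on a finite-dimensional real
normed space `V` whose topological support lies in an open set `U ≠ V` satisfies, for all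
`k, M ∈ ℕ`,

  `(1 + ‖x‖)ᵏ ‖F x‖ ≤ C_{k,M} · dist(x, Uᶜ)ᴹ`   for all `x ∈ V`

(`SchwartzMap.exists_one_add_pow_mul_norm_le_infDist_pow`): at a nearest point `b ∈ Uᶜ` all
derivatives of `F` vanish (`b ∉ tsupport F`), and Taylor's theorem along the segment `[b, x]`
(here: the mean value inequality iterated `M` times on the restriction of `F` to the segment,
`norm_le_mul_pow_of_iteratedDeriv_eq_zero`, `norm_apply_add_le_of_iteratedFDeriv_eq_zero`) bounds
`‖F x‖` by `sup_{[b,x]} ‖Dᴹ F‖ · ‖x − b‖ᴹ`, while the Schwartz decay of `Dᴹ F` supplies the weight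
`(1 + ‖x‖)ᵏ` (for `dist(x, Uᶜ) ≥ 1` the plain Schwartz bound suffices).

Consequence (`SchwartzMap.integrable_mul_of_norm_le_infDist_inv_pow`): if `g` is continuous on
`U` with `‖g x‖ ≤ C (1 + ‖x‖)ᴺ dist(x, Uᶜ)⁻ᴹ` there, then `x ↦ g x · F x` is integrable for every
additive Haar measure — the weight `dist(x, Uᶜ)ᴹ` of `F` cancels the blow-up of `g` and
`(1 + ‖x‖)^{−(dim V + 1)}` is integrable (`integrable_one_add_norm`).

Motivation (not used here): the Euclidean restriction clause
`𝔖ₙ(F) = ∫ 𝔚ₙ(ι x) F(x) dx` of the Osterwalder–Schrader continuation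
(`Literature.MathematicalPhysics.QuantumFieldTheory.IsOSContinuationFamily`) is a Bochner integral
over time-ordered test functions `F` (support in the open set `{0 < x₀⁰ < ⋯ < x_{n−1}⁰}`), and the
continued Schwinger functions are only bounded polynomially in the inverse time gaps
(Osterwalder–Schrader II (1975), eq. (4.6)); the present lemmas give the integrability of the
integrand. Everything here is elementary real analysis. [folklore]

## Mathlib

Used: `norm_image_sub_le_of_norm_deriv_le_segment'` (mean value inequality on a segment),
`ContinuousLinearMap.iteratedFDeriv_comp_right`, `iteratedFDeriv_comp_add_left` (derivatives of
the restriction to a line), `SchwartzMap.one_add_le_sup_seminorm_apply`,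
`IsClosed.exists_infDist_eq_dist` (nearest boundary point, proper space),
`integrable_one_add_norm`.
-/

noncomputable section

open Set Metric MeasureTheory Filter
open scoped SchwartzMap ContDiff Topology

namespace Literature.Analysis.Distribution

variable {V : Type*} [NormedAddCommGroup V] [NormedSpace ℝ V]
variable {E : Type*} [NormedAddCommGroup E] [NormedSpace ℝ E]

/-! ### Flat functions of one real variable -/

/-- **Iterated mean value inequality for a flat function.** If `g : ℝ → E` is smooth, its
derivatives of orders `< M` vanish at `0`, and `‖g⁽ᴹ⁾‖ ≤ B` on `[0, 1]`, then `‖g t‖ ≤ B tᴹ` for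
`t ∈ [0, 1]` (induction on `M`: apply the statement to `g'` and integrate with the mean value
inequality `‖g t − g 0‖ ≤ (sup_{[0,t]} ‖g'‖) t`). [folklore] -/
theorem norm_le_mul_pow_of_iteratedDeriv_eq_zero (M : ℕ) {g : ℝ → E} (hg : ContDiff ℝ ∞ g)
    (h0 : ∀ j < M, iteratedDeriv j g 0 = 0) {B : ℝ}
    (hB : ∀ t ∈ Icc (0 : ℝ) 1, ‖iteratedDeriv M g t‖ ≤ B) {t : ℝ} (ht : t ∈ Icc (0 : ℝ) 1) :
    ‖g t‖ ≤ B * t ^ M := by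
  induction M generalizing g t with
  | zero => simpa using hB t ht
  | succ M ih =>
    have hg' : ContDiff ℝ ∞ (deriv g) := (contDiff_infty_iff_deriv.mp hg).2
    have h0' : ∀ j < M, iteratedDeriv j (deriv g) 0 = 0 := fun j hj => by
      rw [← iteratedDeriv_succ']
      exact h0 (j + 1) (by omega)
    have hB' : ∀ s ∈ Icc (0 : ℝ) 1, ‖iteratedDeriv M (deriv g) s‖ ≤ B := fun s hs => by
      rw [← iteratedDeriv_succ']
      exact hB s hs
    have hder : ∀ s ∈ Icc (0 : ℝ) 1, ‖deriv g s‖ ≤ B * s ^ M := fun s hs => ih hg' h0' hB' hs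
    have hg0 : g 0 = 0 := by simpa using h0 0 (Nat.succ_pos M)
    have hB0 : 0 ≤ B := (norm_nonneg _).trans (hB 0 ⟨le_rfl, zero_le_one⟩)
    have hdiff : Differentiable ℝ g := hg.differentiable (by simp)
    have hmv := norm_image_sub_le_of_norm_deriv_le_segment' (f := g) (f' := deriv g) (a := 0)
      (b := t) (C := B * t ^ M) (fun x _ => (hdiff x).hasDerivAt.hasDerivWithinAt)
      (fun x hx => ?_) t ⟨ht.1, le_rfl⟩
    · rw [hg0, sub_zero, sub_zero] at hmv
      calc ‖g t‖ ≤ B * t ^ M * t := hmv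
        _ = B * t ^ (M + 1) := by ring
    · have hx1 : x ∈ Icc (0 : ℝ) 1 := ⟨hx.1, hx.2.le.trans ht.2⟩
      calc ‖deriv g x‖ ≤ B * x ^ M := hder x hx1
        _ ≤ B * t ^ M := by
          gcongr
          · exact hx.1
          · exact hx.2.le

/-! ### Flat functions of several variables, along a segment -/

/-- **Taylor bound along a segment from a flat point.** If `F : V → E` is smooth, all its
derivatives of orders `< M` vanish at `b`, and `‖Dᴹ F‖ ≤ B` on the segment `[b, b + v]`, then
`‖F (b + v)‖ ≤ B ‖v‖ᴹ` (restrict to the line `t ↦ F (b + t v)`, whose `j`-th derivative is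
`Dʲ F (b + t v) (v, …, v)`, and use `norm_le_mul_pow_of_iteratedDeriv_eq_zero`). [folklore] -/
theorem norm_apply_add_le_of_iteratedFDeriv_eq_zero {F : V → E} (hF : ContDiff ℝ ∞ F) (M : ℕ)
    (b v : V) (h0 : ∀ j < M, iteratedFDeriv ℝ j F b = 0) {B : ℝ}
    (hB : ∀ t ∈ Icc (0 : ℝ) 1, ‖iteratedFDeriv ℝ M F (b + t • v)‖ ≤ B) :
    ‖F (b + v)‖ ≤ B * ‖v‖ ^ M := by
  set A : ℝ →L[ℝ] V := ContinuousLinearMap.toSpanSingleton ℝ v with hA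
  have hAt : ∀ t : ℝ, A t = t • v := fun t => rfl
  set Fb : V → E := fun z => F (b + z) with hFb
  have hFb_diff : ContDiff ℝ ∞ Fb := hF.comp (contDiff_const.add contDiff_id)
  set g : ℝ → E := Fb ∘ A with hg
  have hg_diff : ContDiff ℝ ∞ g := hFb_diff.comp A.contDiff
  have hg_apply : ∀ t, g t = F (b + t • v) := fun t => rfl
  -- the derivatives of the restriction to the line
  have hderiv : ∀ (j : ℕ) (t : ℝ),
      iteratedDeriv j g t = iteratedFDeriv ℝ j F (b + t • v) fun _ => v := by
    intro j t
    rw [iteratedDeriv_eq_iteratedFDeriv, hg,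
      A.iteratedFDeriv_comp_right hFb_diff t (i := j) (by exact_mod_cast le_top),
      ContinuousMultilinearMap.compContinuousLinearMap_apply]
    have h1 : iteratedFDeriv ℝ j Fb (A t) = iteratedFDeriv ℝ j F (b + t • v) := by
      rw [hFb, iteratedFDeriv_comp_add_left, hAt]
    rw [h1]
    congr 1
    funext i
    simp [hAt]
  have h0' : ∀ j < M, iteratedDeriv j g 0 = 0 := fun j hj => by
    rw [hderiv, zero_smul, add_zero, h0 j hj, zero_apply]
  have hB' : ∀ t ∈ Icc (0 : ℝ) 1, ‖iteratedDeriv M g t‖ ≤ B * ‖v‖ ^ M := fun t ht => by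
    rw [hderiv]
    calc ‖iteratedFDeriv ℝ M F (b + t • v) fun _ => v‖
        ≤ ‖iteratedFDeriv ℝ M F (b + t • v)‖ * ∏ _i : Fin M, ‖v‖ :=
          ContinuousMultilinearMap.le_opNorm _ _
      _ = ‖iteratedFDeriv ℝ M F (b + t • v)‖ * ‖v‖ ^ M := by
          rw [Finset.prod_const, Finset.card_univ, Fintype.card_fin]
      _ ≤ B * ‖v‖ ^ M := by gcongr; exact hB t ht
  have := norm_le_mul_pow_of_iteratedDeriv_eq_zero M hg_diff h0' hB' (t := 1)
    ⟨zero_le_one, le_rfl⟩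
  simpa [hg_apply] using this

omit [NormedSpace ℝ V] in
/-- If `‖y - x‖ ≤ 1` then `1 + ‖x‖ ≤ 2 (1 + ‖y‖)`. [folklore] -/
theorem one_add_norm_le_two_mul {x y : V} (h : ‖y - x‖ ≤ 1) : 1 + ‖x‖ ≤ 2 * (1 + ‖y‖) := by
  have : ‖x‖ ≤ ‖y‖ + ‖y - x‖ := by
    calc ‖x‖ = ‖y - (y - x)‖ := by rw [sub_sub_cancel]
      _ ≤ ‖y‖ + ‖y - x‖ := norm_sub_le _ _
  linarith [norm_nonneg y]

/-! ### Schwartz functions supported in an open set -/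

variable [FiniteDimensional ℝ V]

/-- **Quantitative flatness of a Schwartz function at the boundary of an open set containing its
support.** Let `F ∈ 𝓢(V, E)` with `tsupport F ⊆ U`, `U` open, `Uᶜ` nonempty. Then for all
`k, M ∈ ℕ` there is `C ≥ 0` with `(1 + ‖x‖)ᵏ ‖F x‖ ≤ C · (infDist x Uᶜ)ᴹ` for every `x ∈ V`.
Proof: for `infDist x Uᶜ ≥ 1` this is the Schwartz bound; otherwise pick a nearest point `b ∈ Uᶜ`
(`V` is proper), where all derivatives of `F` vanish, and apply
`norm_apply_add_le_of_iteratedFDeriv_eq_zero` on `[b, x]` together with the Schwartz decay of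
`Dᴹ F` on that segment (whose points are within distance `1` of `x`). [folklore] -/
theorem _root_.SchwartzMap.exists_one_add_pow_mul_norm_le_infDist_pow (F : 𝓢(V, E)) {U : Set V}
    (hU : IsOpen U) (hUc : Uᶜ.Nonempty) (hsupp : tsupport (F : V → E) ⊆ U) (k M : ℕ) :
    ∃ C : ℝ, 0 ≤ C ∧ ∀ x : V, (1 + ‖x‖) ^ k * ‖F x‖ ≤ C * infDist x Uᶜ ^ M := by
  -- one Schwartz constant controlling `F` and `Dᴹ F` with weight `(1 + ‖·‖)ᵏ`
  set S : ℝ := 2 ^ k * (Finset.Iic (k, M)).sup (fun m => SchwartzMap.seminorm ℝ m.1 m.2) F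
    with hS
  have hS0 : 0 ≤ S := by positivity
  have hSF : ∀ y : V, (1 + ‖y‖) ^ k * ‖F y‖ ≤ S := fun y => by
    have h := SchwartzMap.one_add_le_sup_seminorm_apply (𝕜 := ℝ) (m := (k, M)) (k := k) (n := 0)
      le_rfl (Nat.zero_le M) F y
    simpa [norm_iteratedFDeriv_zero] using h
  have hSD : ∀ y : V, (1 + ‖y‖) ^ k * ‖iteratedFDeriv ℝ M F y‖ ≤ S := fun y =>
    SchwartzMap.one_add_le_sup_seminorm_apply (𝕜 := ℝ) (m := (k, M)) (k := k) (n := M)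
      le_rfl le_rfl F y
  refine ⟨2 ^ k * S, by positivity, fun x => ?_⟩
  have hx0 : 0 < 1 + ‖x‖ := by positivity
  by_cases hxU : x ∈ U
  swap
  · -- outside `U` the function vanishes
    have hFx : F x = 0 := image_eq_zero_of_notMem_tsupport fun h => hxU (hsupp h)
    rw [hFx, norm_zero, mul_zero]
    exact mul_nonneg (by positivity) (pow_nonneg infDist_nonneg _)
  set r : ℝ := infDist x Uᶜ with hr
  have hr0 : 0 ≤ r := infDist_nonneg
  by_cases hr1 : 1 ≤ r
  · -- far from the boundary: the plain Schwartz bound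
    calc (1 + ‖x‖) ^ k * ‖F x‖ ≤ S := hSF x
      _ ≤ 2 ^ k * S * r ^ M := by
        have h1 : S ≤ 2 ^ k * S := le_mul_of_one_le_left hS0 (one_le_pow₀ (by norm_num))
        have h2 : (1 : ℝ) ≤ r ^ M := one_le_pow₀ hr1
        nlinarith [mul_nonneg (by positivity : (0 : ℝ) ≤ 2 ^ k) hS0]
  · -- near the boundary: Taylor from a nearest boundary point
    push Not at hr1
    obtain ⟨b, hbU, hbd⟩ := hU.isClosed_compl.exists_infDist_eq_dist hUc x
    have hb : b ∉ tsupport (F : V → E) := fun h => hbU (hsupp h)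
    set v : V := x - b with hv
    have hxv : b + v = x := by rw [hv, add_sub_cancel]
    have hvr : ‖v‖ = r := by rw [hr, hbd, dist_eq_norm]
    -- all derivatives of `F` vanish at `b ∉ tsupport F`
    -- (`Literature.Analysis.Distribution.iteratedFDeriv_eq_zero_of_notMem_tsupport` of
    -- `ConeCutoffEstimates`, inlined to keep the imports minimal)
    have h0 : ∀ j < M, iteratedFDeriv ℝ j F b = 0 := fun j _ =>
      image_eq_zero_of_notMem_tsupport fun h => hb (tsupport_iteratedFDeriv_subset j h)
    -- bound of `Dᴹ F` on the segment, with the weight of `x`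
    set B : ℝ := 2 ^ k * S / (1 + ‖x‖) ^ k with hBdef
    have hB : ∀ t ∈ Icc (0 : ℝ) 1, ‖iteratedFDeriv ℝ M F (b + t • v)‖ ≤ B := by
      intro t ht
      set y := b + t • v with hy
      have hyx : ‖y - x‖ ≤ 1 := by
        have : y - x = (t - 1) • v := by
          rw [hy, ← hxv, sub_smul, one_smul]; abel
        rw [this, norm_smul, Real.norm_eq_abs, abs_of_nonpos (by linarith [ht.2]), hvr]
        nlinarith [ht.1, ht.2]
      have hw : (1 + ‖x‖) ^ k ≤ 2 ^ k * (1 + ‖y‖) ^ k := by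
        rw [← mul_pow]
        exact pow_le_pow_left₀ hx0.le (one_add_norm_le_two_mul hyx) k
      rw [hBdef, le_div_iff₀ (pow_pos hx0 k)]
      calc ‖iteratedFDeriv ℝ M F y‖ * (1 + ‖x‖) ^ k
          ≤ ‖iteratedFDeriv ℝ M F y‖ * (2 ^ k * (1 + ‖y‖) ^ k) := by gcongr
        _ = 2 ^ k * ((1 + ‖y‖) ^ k * ‖iteratedFDeriv ℝ M F y‖) := by ring
        _ ≤ 2 ^ k * S := by gcongr; exact hSD y
    have hmain := norm_apply_add_le_of_iteratedFDeriv_eq_zero (F.smooth ⊤) M b v h0 hB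
    rw [hxv, hvr] at hmain
    calc (1 + ‖x‖) ^ k * ‖F x‖ ≤ (1 + ‖x‖) ^ k * (B * r ^ M) := by gcongr
      _ = 2 ^ k * S * r ^ M := by
        rw [hBdef]
        field_simp

/-! ### Integrability against kernels with polynomial blow-up at the boundary -/

/-- A function continuous on an open set `U`, multiplied by a continuous function whose
topological support lies in `U`, is continuous everywhere (private copy of the elementary lemma
`Literature.MathematicalPhysics.QuantumFieldTheory.continuous_mul_of_tsupport_subset` of `Wightman`,
which a generic analysis file must not import). [folklore] -/
private theorem continuous_mul_of_continuousOn_of_tsupport_subset {X : Type*} [TopologicalSpace X]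
    {U : Set X} (hU : IsOpen U) {g φ : X → ℂ} (hg : ContinuousOn g U) (hφ : Continuous φ)
    (hsupp : tsupport φ ⊆ U) : Continuous fun x => g x * φ x := by
  refine continuous_iff_continuousAt.2 fun x => ?_
  by_cases hx : x ∈ tsupport φ
  · exact (hg.continuousAt (hU.mem_nhds (hsupp hx))).mul hφ.continuousAt
  · have hφ0 : φ =ᶠ[𝓝 x] 0 := notMem_tsupport_iff_eventuallyEq.1 hx
    refine Filter.EventuallyEq.continuousAt (y := 0) ?_
    filter_upwards [hφ0] with y hy
    simp [hy]

variable [MeasurableSpace V] [BorelSpace V]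

/-- **Integrability of a Schwartz function against a kernel blowing up polynomially at the
boundary of an open set containing its support.** Let `U` be open with `Uᶜ` nonempty,
`g` continuous on `U` with `‖g x‖ ≤ C (1 + ‖x‖)ᴺ (infDist x Uᶜ)⁻ᴹ` for `x ∈ U`, and
`F ∈ 𝓢(V, ℂ)` with `tsupport F ⊆ U`. Then `x ↦ g x · F x` is integrable for every additive Haar
measure `μ` on `V`: by `SchwartzMap.exists_one_add_pow_mul_norm_le_infDist_pow` with
`k = N + dim V + 1` the product is dominated by a constant times `(1 + ‖x‖)^{−(dim V + 1)}`
(`integrable_one_add_norm`). [folklore] -/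
theorem _root_.SchwartzMap.integrable_mul_of_norm_le_infDist_inv_pow (μ : Measure V)
    [μ.IsAddHaarMeasure] {U : Set V} (hU : IsOpen U) (hUc : Uᶜ.Nonempty) {g : V → ℂ}
    (hg : ContinuousOn g U) {C : ℝ} {N M : ℕ}
    (hbound : ∀ x ∈ U, ‖g x‖ ≤ C * (1 + ‖x‖) ^ N * (infDist x Uᶜ)⁻¹ ^ M)
    (F : 𝓢(V, ℂ)) (hsupp : tsupport (F : V → ℂ) ⊆ U) :
    Integrable (fun x => g x * F x) μ := by
  set D : ℕ := Module.finrank ℝ V with hD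
  obtain ⟨C', hC'0, hC'⟩ :=
    F.exists_one_add_pow_mul_norm_le_infDist_pow hU hUc hsupp (N + (D + 1)) M
  set Cp : ℝ := max C 0 with hCp
  have hCp0 : 0 ≤ Cp := le_max_right _ _
  have hcont : Continuous fun x => g x * F x :=
    continuous_mul_of_continuousOn_of_tsupport_subset hU hg F.continuous hsupp
  have hdom : Integrable (fun x : V => Cp * C' * (1 + ‖x‖) ^ (-((D : ℝ) + 1))) μ :=
    (integrable_one_add_norm (by rw [hD]; linarith)).const_mul (Cp * C')
  refine hdom.mono' hcont.aestronglyMeasurable (Eventually.of_forall fun x => ?_)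
  have hx0 : 0 < 1 + ‖x‖ := by positivity
  have hrpow : (1 + ‖x‖) ^ (-((D : ℝ) + 1)) = ((1 + ‖x‖) ^ (D + 1))⁻¹ := by
    rw [Real.rpow_neg hx0.le, ← Real.rpow_natCast]
    push_cast
    ring_nf
  by_cases hxU : x ∈ U
  swap
  · have hFx : F x = 0 := image_eq_zero_of_notMem_tsupport fun h => hxU (hsupp h)
    rw [hFx, mul_zero, norm_zero, hrpow]
    positivity
  set r : ℝ := infDist x Uᶜ with hr
  have hrpos : 0 < r := (hU.isClosed_compl.notMem_iff_infDist_pos hUc).1 (fun h => h hxU)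
  have hg1 : ‖g x‖ ≤ Cp * (1 + ‖x‖) ^ N * r⁻¹ ^ M :=
    (hbound x hxU).trans (by gcongr; exact le_max_left _ _)
  have hF1 : ‖F x‖ ≤ C' * r ^ M / (1 + ‖x‖) ^ (N + (D + 1)) := by
    rw [le_div_iff₀ (pow_pos hx0 _), mul_comm]
    exact hC' x
  rw [norm_mul, hrpow]
  calc ‖g x‖ * ‖F x‖
      ≤ (Cp * (1 + ‖x‖) ^ N * r⁻¹ ^ M) * (C' * r ^ M / (1 + ‖x‖) ^ (N + (D + 1))) := by
        gcongr
    _ = Cp * C' * ((1 + ‖x‖) ^ (D + 1))⁻¹ * ((r⁻¹ * r) ^ M) := by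
        rw [mul_pow, pow_add]
        field_simp
    _ = Cp * C' * ((1 + ‖x‖) ^ (D + 1))⁻¹ := by
        rw [inv_mul_cancel₀ hrpos.ne', one_pow, mul_one]


/-- **The same with the bound `(1 + dist⁻¹)ᴹ`**: if `‖g x‖ ≤ C (1 + ‖x‖)ᴺ (1 + (infDist x Uᶜ)⁻¹)ᴹ`
on `U` (the shape in which edge estimates usually come, e.g. the Osterwalder–Schrader growth
`(1 + ∑ (time gaps)⁻¹)ᴺ`), then `x ↦ g x · F x` is integrable: since
`1 + r⁻¹ = r⁻¹ (1 + r)` and `1 + infDist x Uᶜ ≤ (1 + ‖b₀‖)(1 + ‖x‖)` for any fixed `b₀ ∈ Uᶜ`, this is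
`SchwartzMap.integrable_mul_of_norm_le_infDist_inv_pow` with exponent `N + M`. [folklore] -/
theorem _root_.SchwartzMap.integrable_mul_of_norm_le_one_add_infDist_inv_pow (μ : Measure V)
    [μ.IsAddHaarMeasure] {U : Set V} (hU : IsOpen U) (hUc : Uᶜ.Nonempty) {g : V → ℂ}
    (hg : ContinuousOn g U) {C : ℝ} {N M : ℕ}
    (hbound : ∀ x ∈ U, ‖g x‖ ≤ C * (1 + ‖x‖) ^ N * (1 + (infDist x Uᶜ)⁻¹) ^ M)
    (F : 𝓢(V, ℂ)) (hsupp : tsupport (F : V → ℂ) ⊆ U) :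
    Integrable (fun x => g x * F x) μ := by
  obtain ⟨b₀, hb₀⟩ := hUc
  refine F.integrable_mul_of_norm_le_infDist_inv_pow μ hU ⟨b₀, hb₀⟩ hg
    (C := max C 0 * (1 + ‖b₀‖) ^ M) (N := N + M) (M := M) (fun x hxU => ?_) hsupp
  set r : ℝ := infDist x Uᶜ with hr
  have hrpos : 0 < r := (hU.isClosed_compl.notMem_iff_infDist_pos ⟨b₀, hb₀⟩).1 (fun h => h hxU)
  have hx0 : 0 < 1 + ‖x‖ := by positivity
  -- `1 + r ≤ (1 + ‖b₀‖)(1 + ‖x‖)`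
  have hr1 : 1 + r ≤ (1 + ‖b₀‖) * (1 + ‖x‖) := by
    have h1 : r ≤ ‖x‖ + ‖b₀‖ := by
      calc r ≤ dist x b₀ := infDist_le_dist_of_mem hb₀
        _ = ‖x - b₀‖ := dist_eq_norm _ _
        _ ≤ ‖x‖ + ‖b₀‖ := norm_sub_le _ _
    nlinarith [norm_nonneg x, norm_nonneg b₀]
  -- `1 + r⁻¹ = r⁻¹ (1 + r)`
  have hinv : 1 + r⁻¹ = r⁻¹ * (1 + r) := by field_simp; ring
  calc ‖g x‖ ≤ C * (1 + ‖x‖) ^ N * (1 + r⁻¹) ^ M := hbound x hxU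
    _ ≤ max C 0 * (1 + ‖x‖) ^ N * (1 + r⁻¹) ^ M := by gcongr; exact le_max_left _ _
    _ = max C 0 * (1 + ‖x‖) ^ N * (r⁻¹ ^ M * (1 + r) ^ M) := by rw [hinv, mul_pow]
    _ ≤ max C 0 * (1 + ‖x‖) ^ N * (r⁻¹ ^ M * ((1 + ‖b₀‖) * (1 + ‖x‖)) ^ M) := by
        gcongr
    _ = max C 0 * (1 + ‖b₀‖) ^ M * (1 + ‖x‖) ^ (N + M) * r⁻¹ ^ M := by
        rw [mul_pow, pow_add]; ring

end Literature.Analysis.Distribution
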